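import Literature.NumberTheory.LFunctions.RayClassLogFreeZeroSide
import Literature.NumberTheory.LFunctions.RayClassSieveConstParam
import Literature.NumberTheory.LFunctions.RayClassOfIdealHom
import Literature.NumberTheory.LFunctions.ClassGroupLogFreeSieveSide
import HarnessLib

/-!
# Bombieri's Théorème 14 for the characters of a congruence class group `mod 𝔪`, II: the sieve side

Topic `Literature/NumberTheory/LFunctions`, namespace `Literature.NumberTheory.LFunctions.AbelianDensity`.
Everything here is PROVED (two definitions with bodies, theorems; no named facts).

The ray-class counterpart of the tree's `ClassGroupLogFreeSieveSide.lean`.  For an abelian Frobenius datum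
`f : 𝔭 ↦ f 𝔭 ∈ G` killing the narrow ray `mod 𝔪 ≠ 0` whose non-trivial characters are non-principal on the primes
`∤ 𝔪` (the characters of a congruence class group `H ⊇ P^𝔪`):
* `datumData`, `datumL` — for `ψ ≠ 0` the primitive data (`RayClassLFunctionLocal`) of the ray class character
  `ψ ∘ f mod 𝔪`, chosen once and for all, and its entire Hecke `L`-function `L_ψ` (`0` for `ψ = 0`);
* `summatory_coefSiftedB_eq_sum_normIdeals` — for `N𝔪 ≤ z` the sifted sums of Lemme B (coefficients `Λ_{χ₀}`
  of the primitive associate `χ₀` of `ψ ∘ f`) are `Σ_{𝔫 : N𝔫 ∈ G, N𝔫 ≤ t} (Λ(𝔫)/(n_K N𝔫)) ψ(F(𝔫)) N𝔫^{−iv}`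
  (`z`-sifted ideals are prime to `𝔪` ⊇ `𝔣`, where `χ₀` and `ψ ∘ f` agree);
* `sieveSide_congruence` — **the sieve side** (the log-free mean value theorem
  `RayClassMeanValue.congruence_meanValue_le` in place of Bombieri's Théorème 11): for `N𝔪 ≤ z`,
  `1 ≤ z ≤ ⌊x^{a₀}⌋`, `0 < T'`, `m ≥ n_K + 3`, `(m+1)T'² ≤ 3A²`, and every `t`,
  `Σ_ψ ∫_{−T'}^{T'} ‖Σ_{𝔫 : N𝔫 ∈ G, N𝔫 ≤ t} (Λ(𝔫)/(n_K N𝔫)) ψ(F(𝔫)) N𝔫^{−iv}‖² dv ≤ 8π |G| M_𝔪 (1/n_K) Σ_{n ∈ G, n ≤ t} Λ(n) log n/n`;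
* `rayLemmaAHeight_le_of_le` — `ℒ'_v ≤ 3888000 (n+1)² log P` for `n_K ≤ n`, `|d_K|, N𝔪 ≤ P`, `|v| ≤ P + 1`.

## References
* [Bombieri1987GrandCrible] E. Bombieri, Astérisque 18 (1987), §6 Théorème 14 (proof, p. 50).
* [ThornerZaman2017] J. Thorner, A. Zaman, Algebra Number Theory 11 (2017), Theorem 4.1, §5.
* [Weiss1983] A. Weiss, J. reine angew. Math. 338 (1983), Theorem 4.3.
-/

noncomputable section

open Complex Finset Filter Real MeasureTheory NumberField IsDedekindDomain
open scoped LSeries.notation ArithmeticFunction.vonMangoldt Topology Nat NumberField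

namespace Literature.NumberTheory.LFunctions.AbelianDensity

open Literature.NumberTheory.LFunctions.LogFreeLocal Literature.NumberTheory.LFunctions.LogFreeDensity
  Literature.NumberTheory.LFunctions.NumberField Literature.NumberTheory.LFunctions.WeissKernel
open scoped nonZeroDivisors Classical

variable {K : Type*} [Field K] [NumberField K]
variable {G : Type*} [CommGroup G] [Finite G] {𝔪 : Ideal (𝓞 K)} {f : HeightOneSpectrum (𝓞 K) → G}

/-! ### The `L`-functions of the family -/

/-- **The primitive data of the ray class character `ψ ∘ f mod 𝔪`**, `ψ ≠ 0` (chosen by `rayClassPrimitiveData`).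
[cite: ThornerZaman2017, Lemma 5.3] -/
def datumData (h𝔪 : 𝔪 ≠ ⊥) (hray : ArtinKillsRay 𝔪 f)
    (hsep : ∀ χ : AddChar (Additive G) ℂ, χ ≠ 0 →
      ∃ v : HeightOneSpectrum (𝓞 K), ¬ 𝔪 ≤ v.asIdeal ∧ χ (Additive.ofMul (f v)) ≠ 1)
    (ψ : AddChar (Additive G) ℂ) (hψ : ψ ≠ 0) : RayClassPrimitiveData 𝔪 (charFun f ψ) :=
  rayClassPrimitiveData (isRayClassCharacter_toMulHom hray ψ) h𝔪 (hsep ψ hψ)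

/-- **The entire Hecke `L`-function `L_ψ` of the character `ψ` of the congruence class group** (that of the
primitive associate of `ψ ∘ f`; the zero function for `ψ = 0`). [cite: ThornerZaman2017, Lemma 5.3] -/
def datumL (h𝔪 : 𝔪 ≠ ⊥) (hray : ArtinKillsRay 𝔪 f)
    (hsep : ∀ χ : AddChar (Additive G) ℂ, χ ≠ 0 →
      ∃ v : HeightOneSpectrum (𝓞 K), ¬ 𝔪 ≤ v.asIdeal ∧ χ (Additive.ofMul (f v)) ≠ 1)
    (ψ : AddChar (Additive G) ℂ) : ℂ → ℂ :=
  if hψ : ψ = 0 then 0 else (datumData h𝔪 hray hsep ψ hψ).L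

/-- `L_ψ` is the `L`-function of the chosen primitive data (`ψ ≠ 0`). [cite: ThornerZaman2017, Lemma 5.3] -/
theorem datumL_eq (h𝔪 : 𝔪 ≠ ⊥) (hray : ArtinKillsRay 𝔪 f)
    (hsep : ∀ χ : AddChar (Additive G) ℂ, χ ≠ 0 →
      ∃ v : HeightOneSpectrum (𝓞 K), ¬ 𝔪 ≤ v.asIdeal ∧ χ (Additive.ofMul (f v)) ≠ 1)
    {ψ : AddChar (Additive G) ℂ} (hψ : ψ ≠ 0) : datumL h𝔪 hray hsep ψ = (datumData h𝔪 hray hsep ψ hψ).L := by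
  rw [datumL, dif_neg hψ]

/-! ### The sifted sums of Lemme B are the sieve-side sums -/

omit [Finite G] in
/-- The ideals with norm in the sifted set are prime to `𝔪` once `N𝔪 ≤ z`. [cite: ThornerZaman2017, Theorem 4.1] -/
theorem isCoprime_of_mem_normIdeals_siftedSet (h𝔪 : 𝔪 ≠ ⊥) {x : ℝ} {z : ℕ} {t : ℝ}
    (hmz : ((Ideal.absNorm 𝔪 : ℕ) : ℝ) ≤ z) {I : Ideal (𝓞 K)}
    (hI : I ∈ normIdeals K ((siftedSet x z).filter (fun n => n ≤ ⌊t⌋₊))) : IsCoprime I 𝔪 := by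
  obtain ⟨-, -, hsft⟩ := normIdeals_siftedSet_prop hI
  rw [isCoprime_iff_forall_not_le h𝔪]
  intro v hv hIv
  have hdvd : v.asIdeal ∣ 𝔪 := Ideal.dvd_iff_le.mpr hv
  have hN : ((Ideal.absNorm v.asIdeal : ℕ) : ℝ) ≤ (Ideal.absNorm 𝔪 : ℕ) := by
    have h1 : Ideal.absNorm v.asIdeal ∣ Ideal.absNorm 𝔪 := map_dvd Ideal.absNorm hdvd
    have h2 : Ideal.absNorm 𝔪 ≠ 0 := by rwa [Ne, Ideal.absNorm_eq_zero_iff]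
    exact_mod_cast Nat.le_of_dvd (Nat.pos_of_ne_zero h2) h1
  exact hsft v (hN.trans hmz) (Ideal.dvd_iff_le.mpr hIv)

omit [Finite G] in
/-- **The sifted sums of the primitive associate are the sieve-side sums**: for `ψ ∘ f mod 𝔪` with primitive data
`D` and `N𝔪 ≤ z`, `S_{D,v}(t) = Σ_{𝔫 : N𝔫 ∈ G, N𝔫 ≤ t} (Λ(𝔫)/(n_K N𝔫)) ψ(F(𝔫)) e^{−(v log N𝔫) i}`
(the `z`-sifted ideals are prime to `𝔪`, where `χ₀ = ψ ∘ f`). [cite: Bombieri1987GrandCrible, §6 Théorème 14 (proof)] -/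
theorem summatory_coefSiftedB_eq_sum_normIdeals (h𝔪 : 𝔪 ≠ ⊥) (ψ : AddChar (Additive G) ℂ)
    (D : RayClassPrimitiveData 𝔪 (charFun f ψ)) (v x : ℝ) {z : ℕ} (hmz : ((Ideal.absNorm 𝔪 : ℕ) : ℝ) ≤ z)
    (t : ℝ) :
    summatory (coefSiftedB (D.coefB v) x z) t =
      ∑ J ∈ normIdeals K ((siftedSet x z).filter (fun n => n ≤ ⌊t⌋₊)),
        (((idealVonMangoldt J / (Module.finrank ℚ K * Ideal.absNorm J) : ℝ)) : ℂ) *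
          ψ (Additive.ofMul (artinSymbol f J)) *
          Complex.exp (-((v : ℂ) * (Real.log (Ideal.absNorm J) : ℂ)) * Complex.I) := by
  unfold summatory
  have h1 : ∀ i ∈ Finset.Icc 0 ⌊t⌋₊, coefSiftedB (D.coefB v) x z i =
      if i ∈ siftedSet x z then D.coefB v i else 0 := by
    intro i _; rfl
  rw [sum_congr rfl h1, ← sum_filter]
  have hset : (Finset.Icc 0 ⌊t⌋₊).filter (fun i ↦ i ∈ siftedSet x z) = (siftedSet x z).filter (fun n ↦ n ≤ ⌊t⌋₊) := by
    ext n; simp only [mem_filter, Finset.mem_Icc, Nat.zero_le, true_and]; tauto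
  rw [hset, sum_normIdeals_eq]
  refine Finset.sum_congr rfl fun n hn ↦ ?_
  have hnG := (mem_filter.mp hn).1
  have hn0 : n ≠ 0 := by have := (siftedSet_prop hnG).1; omega
  rw [RayClassPrimitiveData.coefB, twistVonMangoldt, Finset.sum_mul, Finset.sum_div]
  refine Finset.sum_congr rfl fun J hJ ↦ ?_
  have hJG : J ∈ normIdeals K ((siftedSet x z).filter (fun n => n ≤ ⌊t⌋₊)) := by
    rw [mem_normIdeals, mem_idealsOfNorm.mp hJ]; exact hn
  have hJ0 : J ≠ ⊥ := (normIdeals_siftedSet_prop hJG).1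
  have hJcop : IsCoprime J 𝔪 := isCoprime_of_mem_normIdeals_siftedSet h𝔪 hmz hJG
  -- `χ₀(J) = ψ(F(J))`
  have hcoef : rayClassCoeffHom D.𝔣 D.χ₀ J = ψ (Additive.ofMul (artinSymbol f J)) := by
    rw [rayClassCoeffHom_apply, rayClassCoeff, if_pos ⟨hJ0, isCoprime_of_le_right hJcop D.le⟩,
      idealPow_congr_of_isCoprime h𝔪 D.agree hJ0 hJcop,
      show charFun f ψ = fun v ↦ toMulHom ψ (f v) from rfl, idealPow_comp_eq (toMulHom ψ) f hJ0, toMulHom_apply]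
  rw [mem_idealsOfNorm] at hJ
  rw [hcoef, hJ, natCast_cpow_neg_one_add_mul_I hn0 v]
  have hnK : (Module.finrank ℚ K : ℂ) ≠ 0 := by exact_mod_cast (Module.finrank_pos (R := ℚ) (M := K)).ne'
  have hnC : (n : ℂ) ≠ 0 := by exact_mod_cast hn0
  push_cast
  field_simp

/-! ### The sieve side -/

/-- **The sieve side of Théorème 14 for a congruence class group `mod 𝔪`** (the log-free mean value theorem of
Thorner–Zaman/Weiss in place of Bombieri's Théorème 11): for `N𝔪 ≤ z`, `1 ≤ z ≤ ⌊x^{a₀}⌋`, `0 < T'`, `m ≥ n_K + 3`,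
`(m+1)T'² ≤ 3A²`, and every `t`, with `G_t = {n ∈ G : n ≤ t}` the sifted prime powers,
`Σ_ψ ∫_{−T'}^{T'} ‖Σ_{𝔫 : N𝔫 ∈ G_t} (Λ(𝔫)/(n_K N𝔫)) ψ(F(𝔫)) e^{−(v log N𝔫)i}‖² dv ≤ 8π |G| M_𝔪 · (1/n_K) Σ_{n ∈ G_t} Λ(n) log n / n`,
`M_𝔪 = rayMeanValueConst K 𝔪 |G| A m z ⌊x^{a₀}⌋`. [cite: ThornerZaman2017, Theorem 4.1] -/
theorem sieveSide_congruence (h𝔪 : 𝔪 ≠ ⊥) (hray : ArtinKillsRay 𝔪 f)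
    (hsep : ∀ χ : AddChar (Additive G) ℂ, χ ≠ 0 →
      ∃ v : HeightOneSpectrum (𝓞 K), ¬ 𝔪 ≤ v.asIdeal ∧ χ (Additive.ofMul (f v)) ≠ 1)
    (x : ℝ) {z : ℕ} (hz1 : 1 ≤ z) (hzx : z ≤ ⌊x ^ expoB⌋₊) (hmz : ((Ideal.absNorm 𝔪 : ℕ) : ℝ) ≤ z)
    {T' A : ℝ} {m : ℕ} (hT : 0 < T') (hA : 0 < A) (hm : Module.finrank ℚ K + 3 ≤ m)
    (hTA : ((m : ℝ) + 1) * T' ^ 2 ≤ 3 * A ^ 2) (t : ℝ) :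
    ∑ ψ : AddChar (Additive G) ℂ,
        ∫ v in (-T')..T', ‖∑ J ∈ normIdeals K ((siftedSet x z).filter (fun n => n ≤ ⌊t⌋₊)),
          (((idealVonMangoldt J / (Module.finrank ℚ K * Ideal.absNorm J) : ℝ)) : ℂ) *
            ψ (Additive.ofMul (artinSymbol f J)) *
            Complex.exp (-(v * Real.log (Ideal.absNorm J)) * Complex.I)‖ ^ 2 ≤
      8 * π * (Nat.card G * rayMeanValueConst K 𝔪 h𝔪 (Nat.card G) A m z ⌊x ^ expoB⌋₊ *
        ((1 / (Module.finrank ℚ K : ℝ)) * ∑ n ∈ (siftedSet x z).filter (fun n => n ≤ ⌊t⌋₊), Λ n * Real.log n / n)) := by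
  set Gt := (siftedSet x z).filter (fun n => n ≤ ⌊t⌋₊) with hGt
  set Pset := normIdeals K Gt with hPset
  set b : Ideal (𝓞 K) → ℂ := fun I ↦ (((idealVonMangoldt I / (Module.finrank ℚ K * Ideal.absNorm I) : ℝ)) : ℂ) with hb
  have hz : (1 : ℝ) ≤ z := by exact_mod_cast hz1
  have hzy : (z : ℝ) ≤ (⌊x ^ expoB⌋₊ : ℕ) := by exact_mod_cast hzx
  have hmv := congruence_meanValue_le h𝔪 hray hsep Pset b hA hm hT hTA hz hzy
    (fun I hI ↦ (normIdeals_siftedSet_prop hI).1)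
    (fun I hI ↦ isCoprime_of_mem_normIdeals_siftedSet h𝔪 hmz hI)
    (fun I hI w hw _ ↦ (normIdeals_siftedSet_prop hI).2.2 w hw)
    (fun I hI ↦ (normIdeals_siftedSet_prop hI).2.1)
  refine hmv.trans ?_
  have hM0 : 0 ≤ (Nat.card G : ℝ) * rayMeanValueConst K 𝔪 h𝔪 (Nat.card G) A m z ⌊x ^ expoB⌋₊ :=
    mul_nonneg (Nat.cast_nonneg _) (rayMeanValueConst_nonneg h𝔪 _ A m hz _)
  refine mul_le_mul_of_nonneg_left (mul_le_mul_of_nonneg_left ?_ hM0) (by positivity)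
  have hnK : (0 : ℝ) < Module.finrank ℚ K := by exact_mod_cast Module.finrank_pos (R := ℚ) (M := K)
  rw [hPset, sum_normIdeals_eq, Finset.mul_sum]
  refine Finset.sum_le_sum fun n hn ↦ ?_
  have hn0 : n ≠ 0 := by have := (siftedSet_prop (mem_filter.mp hn).1).1; omega
  have hn0' : (0 : ℝ) < n := by exact_mod_cast Nat.pos_of_ne_zero hn0
  have hterm : ∀ I ∈ idealsOfNorm K n, (Ideal.absNorm I : ℝ) * ‖b I‖ ^ 2 =
      idealVonMangoldt I ^ 2 / ((Module.finrank ℚ K : ℝ) ^ 2 * n) := by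
    intro I hI
    rw [mem_idealsOfNorm] at hI
    rw [hb]; dsimp only
    rw [Complex.norm_real, Real.norm_eq_abs, sq_abs, hI]
    field_simp
  rw [Finset.sum_congr rfl hterm, ← Finset.sum_div]
  have hsq := sum_idealVonMangoldt_sq_le (K := K) n
  rw [div_le_iff₀ (by positivity)]
  calc ∑ I ∈ idealsOfNorm K n, idealVonMangoldt I ^ 2 ≤ Module.finrank ℚ K * Λ n * Real.log n := hsq
    _ = 1 / (Module.finrank ℚ K : ℝ) * (Λ n * Real.log n / n) * ((Module.finrank ℚ K : ℝ) ^ 2 * n) := by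
        field_simp

/-! ### The height `ℒ'_v ≤ 3888000 (n+1)² log P` -/

/-- **`ℳ_v ≤ 10(n+1) log P`** for `n_K ≤ n`, `|d_K| ≤ P`, `N𝔪 ≤ P`, `P ≥ 2`, `|v| ≤ P + 2`. [cite: ThornerZaman2017, Lemma 2.5] -/
theorem rayDiscBound_le_of_le {n : ℕ} (hn : Module.finrank ℚ K ≤ n) {P : ℝ} (hP : 2 ≤ P)
    (hd : ((NumberField.discr K).natAbs : ℝ) ≤ P) (hN𝔪 : ((Ideal.absNorm 𝔪 : ℕ) : ℝ) ≤ P) (h𝔪 : 𝔪 ≠ ⊥)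
    {v : ℝ} (hv : |v| ≤ P + 2) :
    rayDiscBound K 𝔪 v ≤ 10 * ((n : ℝ) + 1) * Real.log P := by
  set Lp := Real.log P with hLp
  have hP0 : 0 < P := by linarith
  have hl2 : (0.69 : ℝ) ≤ Lp := by
    have := Real.log_two_gt_d9; have := Real.log_le_log (by norm_num) hP; rw [hLp]; linarith
  have hnr : (Module.finrank ℚ K : ℝ) ≤ n := by exact_mod_cast hn
  have hn0 : (0 : ℝ) ≤ Module.finrank ℚ K := Nat.cast_nonneg _
  have hd1 : (1 : ℝ) ≤ ((NumberField.discr K).natAbs : ℝ) := one_le_natAbs_discr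
  have hm1 : (1 : ℝ) ≤ ((Ideal.absNorm 𝔪 : ℕ) : ℝ) := by
    exact_mod_cast Nat.one_le_iff_ne_zero.mpr (by rwa [Ne, Ideal.absNorm_eq_zero_iff])
  have hlogdm : Real.log (((NumberField.discr K).natAbs : ℝ) * ((Ideal.absNorm 𝔪 : ℕ) : ℝ)) ≤ 2 * Lp := by
    rw [Real.log_mul (by positivity) (by positivity)]
    have h1 := Real.log_le_log (by positivity) hd
    have h2 := Real.log_le_log (by positivity) hN𝔪
    linarith
  have hlogv : Real.log (|v| + 7) ≤ 4 * Lp := by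
    have h1 : Real.log (|v| + 7) ≤ Real.log (6 * P) := Real.log_le_log (by positivity) (by linarith)
    rw [Real.log_mul (by norm_num) hP0.ne'] at h1
    have h6 : Real.log 6 ≤ 2 := by
      have : Real.log 6 ≤ Real.log (Real.exp 2) := by
        refine Real.log_le_log (by norm_num) ?_
        have := Real.exp_one_gt_d9
        have h : Real.exp 2 = Real.exp 1 * Real.exp 1 := by rw [← Real.exp_add]; norm_num
        rw [h]; nlinarith
      rwa [Real.log_exp] at this
    linarith
  have hlv0 : 0 ≤ Real.log (|v| + 7) := Real.log_nonneg (by linarith [abs_nonneg v])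
  rw [rayDiscBound]
  have hnLp : (n : ℝ) * 0.69 ≤ (n : ℝ) * Lp := mul_le_mul_of_nonneg_left hl2 (Nat.cast_nonneg n)
  have h3 : 3 * (Module.finrank ℚ K : ℝ) ≤ 5 * (n : ℝ) * Lp := by linarith
  have h4 : (Module.finrank ℚ K : ℝ) * Real.log (|v| + 7) ≤ (n : ℝ) * (4 * Lp) :=
    mul_le_mul hnr hlogv hlv0 (Nat.cast_nonneg n)
  have hnLp0 : 0 ≤ (n : ℝ) * Lp := by positivity
  have hLp0 : 0 ≤ Lp := by linarith
  linarith

/-- **`ℒ'_v ≤ 3888000 (n+1)² log P`** for `n_K ≤ n`, `|d_K| ≤ P`, `N𝔪 ≤ P`, `P ≥ 2`, `|v| ≤ P + 1`.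
[cite: Bombieri1987GrandCrible, §6 Lemme A] -/
theorem rayLemmaAHeight_le_of_le {n : ℕ} (hn : Module.finrank ℚ K ≤ n) {P : ℝ} (hP : 2 ≤ P)
    (hd : ((NumberField.discr K).natAbs : ℝ) ≤ P) (hN𝔪 : ((Ideal.absNorm 𝔪 : ℕ) : ℝ) ≤ P) (h𝔪 : 𝔪 ≠ ⊥)
    {v : ℝ} (hv : |v| ≤ P + 1) :
    rayLemmaAHeight K 𝔪 v ≤ 3888000 * ((n : ℝ) + 1) ^ 2 * Real.log P := by
  have hdisc := rayDiscBound_le_of_le hn hP hd hN𝔪 h𝔪 (show |v| ≤ P + 2 by linarith)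
  have hnr : (Module.finrank ℚ K : ℝ) ≤ n := by exact_mod_cast hn
  rw [rayLemmaAHeight]
  have hcoef : 77760 * (5 * (Module.finrank ℚ K : ℝ) + 2) + 77760 ≤ 388800 * ((n : ℝ) + 1) := by linarith
  have hdb0 : 0 ≤ rayDiscBound K 𝔪 v := le_trans zero_le_one (one_le_rayDiscBound h𝔪 v)
  have hP0 : (0 : ℝ) ≤ Real.log P := Real.log_nonneg (by linarith)
  calc (77760 * (5 * (Module.finrank ℚ K : ℝ) + 2) + 77760) * rayDiscBound K 𝔪 v
      ≤ 388800 * ((n : ℝ) + 1) * (10 * ((n : ℝ) + 1) * Real.log P) :=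
        mul_le_mul hcoef hdisc hdb0 (by positivity)
    _ = 3888000 * ((n : ℝ) + 1) ^ 2 * Real.log P := by ring

end Literature.NumberTheory.LFunctions.AbelianDensity

end
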